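import Literature.Topology.FourManifolds.ImmersionCriterion
import Literature.Topology.FourManifolds.PalaisBallComplement
import HarnessLib

/-!
# The maximum circle of the Morse–Bott function of brick F3 is embedded (layer `f3_embedCircle`)

Auxiliary file (layer 5) of stub `helper_sliceGluing_bottConstruction` (apex brick F3: the
construction of the Morse–Bott function `F` and of the angular map `α`), line `Sketch`, crux
`SblfDescent.RungOne`.

(Crux item stmt-SmoothPoincare4-18531; skeleton `Cruxes/RungOne/Lines/Sketch.lean`.)

The critical circle of the function of brick F3 is the round circle `Z = ν(S¹ × {0})` of the
fibration, parametrised through the `S¹`-parametric fold tube `ν : S¹ × ℝ³ → X` (smooth,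
injective and immersive on `S¹ × B(0, ε)`) as `e u = ν (g u, 0)` with `g` the rotation /
reflection of the circle induced by a linear isometry `O` of the plane (the reparametrisation
making the angular map restrict to the identity on `Z`).  This file proves that **`e` is a
smooth embedding** (injective immersion of the compact circle: the tree's
`isSmoothEmbedding_of_injective_of_injective_mfderiv`, Hirsch 1976, Ch. 1 §3 Thm. 3.1) and
identifies **the range of its differential** with the image under `dν` of the circle direction
`ℝ × {0} ⊂ ℝ × ℝ³` (the kernel of the Bott Hessian): `helper_f3_embedCircle`.

## References

* M. W. Hirsch, *Differential Topology*, GTM 33 (1976), Ch. 1 §3, Thm. 3.1. [HirschDT1976]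
* J. Milnor, *Morse theory*, Ann. of Math. Studies 51 (1963), §2. [Milnor1963]
-/

set_option linter.dupNamespace false

noncomputable section

open scoped Manifold ContDiff Topology
open Set Function Literature.Topology.FourManifolds

namespace Summit.SmoothPoincare4.SmoothPoincare4.Cruxes.RungOne.Sketch

/-- **Layer `f3_embedCircle` of brick F3: the reparametrised zero section of the fold tube is a
smooth embedding of the circle, with differential range the `dν`-image of the circle
direction.**  For `ν : S¹ × ℝ³ → X` smooth, injective and immersive on `S¹ × B(0, ε)` and a
linear isometry `O` of the plane, `e u = ν (O u, 0)` is a `C^∞` embedding `S¹ ↪ X` and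
`range (de_u) = dν_{(O u, 0)} (ℝ × {0})` (injective immersions of compact manifolds are
embeddings, Hirsch 1976, Ch. 1 §3 Thm. 3.1; chain rule).  The `Fact` binder is the dimension
instance of the circle's charts. [cite: HirschDT1976, Ch. 1 §3 Thm. 3.1] -/
theorem helper_f3_embedCircle : ∀ [Fact (Module.finrank ℝ (EuclideanSpace ℝ (Fin 2)) = 1 + 1)] (X : Type) [TopologicalSpace X] [T2Space X] [ChartedSpace (EuclideanSpace ℝ (Fin 4)) X] [IsManifold (𝓡 4) ∞ X] (ε : ℝ) (ν : (Metric.sphere (0 : EuclideanSpace ℝ (Fin 2)) 1) × EuclideanSpace ℝ (Fin 3) → X) (O : EuclideanSpace ℝ (Fin 2) ≃ₗᵢ[ℝ] EuclideanSpace ℝ (Fin 2)), 0 < ε → ContMDiffOn ((𝓡 1).prod 𝓘(ℝ, EuclideanSpace ℝ (Fin 3))) (𝓡 4) ∞ ν (Set.univ ×ˢ Metric.ball 0 ε) → Set.InjOn ν (Set.univ ×ˢ Metric.ball 0 ε) → (∀ p : (Metric.sphere (0 : EuclideanSpace ℝ (Fin 2)) 1) × EuclideanSpace ℝ (Fin 3),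 p.2 ∈ Metric.ball (0 : EuclideanSpace ℝ (Fin 3)) ε → Function.Injective (mfderiv ((𝓡 1).prod 𝓘(ℝ, EuclideanSpace ℝ (Fin 3))) (𝓡 4) ν p)) → Manifold.IsSmoothEmbedding (𝓡 1) (𝓡 4) ∞ (fun u => ν (@LinearIsometryEquiv.sphereDiffeomorph (EuclideanSpace ℝ (Fin 2)) _ _ 1 _ O u, 0)) ∧ (∀ (u : Metric.sphere (0 : EuclideanSpace ℝ (Fin 2)) 1) (w : EuclideanSpace ℝ (Fin 4)), w ∈ Set.range (mfderiv (𝓡 1) (𝓡 4) (fun u => ν (@LinearIsometryEquiv.sphereDiffeomorph (EuclideanSpace ℝ (Fin 2)) _ _ 1 _ O u, 0)) u) ↔ ∃ t : EuclideanSpace ℝ (Fin 1), mfderiv ((𝓡 1).prod 𝓘(ℝ, EuclideanSpace ℝ (Fin 3))) (𝓡 4) ν (@LinearIsometryEquiv.sphereDiffeomorph (EuclideanSpace ℝ (Fin 2)) _ _ 1 _ O u, 0) (t, 0) = w) := by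
  intro _ X _ _ _ _ ε ν O hε hνs hνi hνd
  set g := @LinearIsometryEquiv.sphereDiffeomorph (EuclideanSpace ℝ (Fin 2)) _ _ 1 _ O with hg
  set j : (Metric.sphere (0 : EuclideanSpace ℝ (Fin 2)) 1) →
      (Metric.sphere (0 : EuclideanSpace ℝ (Fin 2)) 1) × EuclideanSpace ℝ (Fin 3) :=
    fun u => (g u, 0) with hj
  have hgs : ContMDiff (𝓡 1) (𝓡 1) ∞ g := g.contMDiff
  have hjs : ContMDiff (𝓡 1) ((𝓡 1).prod 𝓘(ℝ, EuclideanSpace ℝ (Fin 3))) ∞ j :=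
    hgs.prodMk contMDiff_const
  have hmem : ∀ u, j u ∈ (Set.univ : Set (Metric.sphere (0 : EuclideanSpace ℝ (Fin 2)) 1)) ×ˢ
      Metric.ball (0 : EuclideanSpace ℝ (Fin 3)) ε := fun u =>
    ⟨mem_univ _, by simp [j, hε]⟩
  have he : ContMDiff (𝓡 1) (𝓡 4) ∞ (fun u => ν (g u, 0)) := hνs.comp_contMDiff hjs hmem
  -- differentials
  have hn : (∞ : ℕ∞ω) ≠ 0 := by simp
  have hjd : ∀ u, HasMFDerivAt (𝓡 1) ((𝓡 1).prod 𝓘(ℝ, EuclideanSpace ℝ (Fin 3))) j u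
      ((mfderiv (𝓡 1) (𝓡 1) g u).prod 0) := fun u =>
    ((hgs.mdifferentiableAt hn).hasMFDerivAt).prodMk
      (hasMFDerivAt_const (I := 𝓡 1) (I' := 𝓘(ℝ, EuclideanSpace ℝ (Fin 3)))
        (0 : EuclideanSpace ℝ (Fin 3)) u)
  have hνm : ∀ u, MDifferentiableAt ((𝓡 1).prod 𝓘(ℝ, EuclideanSpace ℝ (Fin 3))) (𝓡 4) ν (j u) :=
    fun u => (hνs.contMDiffAt ((isOpen_univ.prod Metric.isOpen_ball).mem_nhds (hmem u)))
      |>.mdifferentiableAt hn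
  have hed : ∀ u, mfderiv (𝓡 1) (𝓡 4) (fun u => ν (g u, 0)) u =
      (mfderiv ((𝓡 1).prod 𝓘(ℝ, EuclideanSpace ℝ (Fin 3))) (𝓡 4) ν (g u, 0)).comp
        ((mfderiv (𝓡 1) (𝓡 1) g u).prod 0) := fun u => by
    have h := mfderiv_comp u (hνm u) (hjd u).mdifferentiableAt
    rw [(hjd u).mfderiv] at h
    exact h
  -- `dg_u` is a linear isomorphism
  have hDg : ∀ u, Function.Bijective (mfderiv (𝓡 1) (𝓡 1) g u) := fun u => by
    have h := (g.mfderivToContinuousLinearEquiv hn u).bijective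
    rw [← ContinuousLinearEquiv.coe_coe, Diffeomorph.mfderivToContinuousLinearEquiv_coe] at h
    exact h
  -- injectivity of `de_u`
  have hd : ∀ u, Function.Injective (mfderiv (𝓡 1) (𝓡 4) (fun u => ν (g u, 0)) u) := by
    intro u
    rw [hed u]
    intro s s' hss'
    simp only [ContinuousLinearMap.coe_comp, comp_apply] at hss'
    have h1 := hνd (g u, 0) (by simp [hε]) hss'
    exact (hDg u).1 (Prod.ext_iff.1 h1).1
  -- injectivity of `e`
  have hinj : Function.Injective (fun u => ν (g u, 0)) := by
    intro u u' h
    have h1 := hνi (hmem u) (hmem u') h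
    exact g.injective (Prod.ext_iff.1 h1).1
  refine ⟨isSmoothEmbedding_of_injective_of_injective_mfderiv he (by simp) hinj hd, fun u w => ?_⟩
  rw [hed u]
  constructor
  · rintro ⟨s, rfl⟩
    exact ⟨mfderiv (𝓡 1) (𝓡 1) g u s, rfl⟩
  · rintro ⟨t, rfl⟩
    obtain ⟨s, hs⟩ := (hDg u).2 t
    refine ⟨s, ?_⟩
    simp only [ContinuousLinearMap.coe_comp, comp_apply]
    rw [← hs]
    rfl

end Summit.SmoothPoincare4.SmoothPoincare4.Cruxes.RungOne.Sketch

end
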